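import Summits.Ventures.PackingBounds.SphericalCodes.TouchingMutuallyTouchingSpheresExists
import Summits.Ventures.PackingBounds.SphericalCodes.KissingAsTouchingSpheres

/-!
# Monotonicity along SPLAG's diagonal: `A(n, arccos 1/(k+3)) ≤ A(n+1, arccos 1/(k+2))`

Framing: lottery ticket; floor = certified bounds/negative ranges. Venture `PackingBounds` (cell `pub-packcert`),
spherical-codes family; a reading lemma for the standard-angle columns `s = 1/2, 1/3, 1/4, 1/5, 1/6, …` of the cell's
tables B1 / B2 / B2c.

Conway–Sloane, *SPLAG* Ch. 14, Theorem 1: the unit spheres of `ℝᵐ` touching `K` given mutually touching unit spheres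
correspond to `(m - K + 1, M, 1/(K + 1))` spherical codes; the cell has this dictionary in BOTH directions
(`exists_code_of_touching`, `exists_touching_of_code`). In sphere language the columns of one ambient dimension are
trivially nested — a sphere touching `K + 1` mutually touching spheres touches the first `K` of them
(`touching_succ_mono`) — and transporting this triviality through the dictionary gives a statement about codes in
DIFFERENT dimensions at DIFFERENT angles (`exists_code_succ_of_code`): every `(n, M, 1/(k+3))` code yields an
`(n + 1, M, 1/(k+2))` code, i.e. `A(n, arccos 1/(k+3)) ≤ A(n+1, arccos 1/(k+2))`; hence an upper bound for the cell
`(n + 1, 1/(k+2))` is an upper bound for the cell `(n, 1/(k+3))` (`code_card_le_of_succ_bound`), a construction for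
`(n, 1/(k+3))` is a lower bound for `(n + 1, 1/(k+2))`, and at the top of each diagonal a `1/3`-code of `ℝⁿ` is the size
of a kissing configuration of `ℝⁿ⁺¹` (`card_mem_kissingSizes_succ_of_third_code`). Example (SPLAG Ch. 14 Example 2, all
exact in the tree): along the `E₈` diagonal `κ(8) = 240 ≥ A(7, 1/3) = 56 ≥ A(6, 1/4) = 27 ≥ A(5, 1/5) = 16 ≥ A(4, 1/6) = 10`.
(A direct proof — append a coordinate `1/(k+2)` and rescale — exists as well; the point of this file is that the
two-sided dictionary makes the inequality a bookkeeping fact.) All statements use Mathlib notions only.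

## References
* J. H. Conway, N. J. A. Sloane, *Sphere Packings, Lattices and Groups*, 3rd ed., Springer 1999, Ch. 14 Theorem 1 and
  Example 2; Ch. 9 Table 9.2. [`ConwaySloane1999`]
-/

noncomputable section

open Finset
open scoped RealInnerProductSpace

namespace Summit.Ventures.PackingBounds.SphericalCodes

/-! ## Sphere language: nesting of the columns is trivial -/

/-- **Monotonicity in `K`, sphere language.** In any normed group: if `M` pairwise `2`-separated points are at distance
`2` from each of `k + 2` points with pairwise distances `2`, then (forgetting the last of those) `M` such points are at
distance `2` from each of `k + 1` points with pairwise distances `2` — unit spheres touching `k + 2` mutually touching unit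
spheres touch the first `k + 1` of them. [cite: ConwaySloane1999, Ch. 14 Theorem 1] -/
theorem touching_succ_mono {E : Type*} [NormedAddCommGroup E] {k M : ℕ}
    (h : ∃ a : Fin (k + 2) → E, (∀ i j, i ≠ j → ‖a i - a j‖ = 2) ∧
      ∃ S : Finset E, S.card = M ∧ (∀ c ∈ S, ∀ i, ‖c - a i‖ = 2) ∧ (∀ c ∈ S, ∀ c' ∈ S, c ≠ c' → 2 ≤ ‖c - c'‖)) :
    ∃ a : Fin (k + 1) → E, (∀ i j, i ≠ j → ‖a i - a j‖ = 2) ∧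
      ∃ S : Finset E, S.card = M ∧ (∀ c ∈ S, ∀ i, ‖c - a i‖ = 2) ∧ (∀ c ∈ S, ∀ c' ∈ S, c ≠ c' → 2 ≤ ‖c - c'‖) := by
  obtain ⟨a, ha, S, hS, hS1, hS2⟩ := h
  exact ⟨fun i => a (Fin.castSucc i), fun i j hij => ha _ _ (fun e => hij (Fin.castSucc_injective _ e)), S, hS,
    fun c hc i => hS1 c hc _, hS2⟩

/-! ## Code language: one step down the diagonal -/

/-- `exists_code_of_touching` with the ambient dimension supplied as `m = n + k` (index bookkeeping only).
[cite: ConwaySloane1999, Ch. 14 Theorem 1] -/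
theorem exists_code_of_touching_cast {m n k : ℕ} (hm : m = n + k) (a : Fin (k + 1) → EuclideanSpace ℝ (Fin m))
    (ha : ∀ i j, i ≠ j → ‖a i - a j‖ = 2) (S : Finset (EuclideanSpace ℝ (Fin m)))
    (hS1 : ∀ c ∈ S, ∀ i, ‖c - a i‖ = 2) (hS2 : ∀ c ∈ S, ∀ c' ∈ S, c ≠ c' → 2 ≤ ‖c - c'‖) :
    ∃ C : Finset (EuclideanSpace ℝ (Fin n)), C.card = S.card ∧ (∀ x ∈ C, ‖x‖ = 1) ∧
      (∀ x ∈ C, ∀ y ∈ C, x ≠ y → inner ℝ x y ≤ 1 / ((k : ℝ) + 2)) := by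
  subst hm
  exact exists_code_of_touching a ha S hS1 hS2

/-- **`A(n, arccos 1/(k+3)) ≤ A(n+1, arccos 1/(k+2))`, as a construction.** A code of unit vectors of `ℝⁿ` with
pairwise inner products `≤ 1/(k+3)` yields a code of the same size in `ℝⁿ⁺¹` with pairwise inner products `≤ 1/(k+2)`.
Proof through SPLAG Ch. 14 Theorem 1 in both directions: realise the code as unit spheres touching `k + 2` mutually
touching unit spheres of `ℝⁿ⁺ᵏ⁺¹` (`exists_touching_of_code`), forget one of the `k + 2` spheres, and read the
configuration back as a code of `ℝ⁽ⁿ⁺¹⁾⁺ᵏ = ℝⁿ⁺ᵏ⁺¹` at angle `arccos 1/(k+2)` (`exists_code_of_touching`).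
[cite: ConwaySloane1999, Ch. 14 Theorem 1] -/
theorem exists_code_succ_of_code {n k : ℕ} (C : Finset (EuclideanSpace ℝ (Fin n))) (h1 : ∀ x ∈ C, ‖x‖ = 1)
    (h2 : ∀ x ∈ C, ∀ y ∈ C, x ≠ y → inner ℝ x y ≤ 1 / ((k : ℝ) + 3)) :
    ∃ C' : Finset (EuclideanSpace ℝ (Fin (n + 1))), C'.card = C.card ∧ (∀ x ∈ C', ‖x‖ = 1) ∧
      (∀ x ∈ C', ∀ y ∈ C', x ≠ y → inner ℝ x y ≤ 1 / ((k : ℝ) + 2)) := by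
  have h2' : ∀ x ∈ C, ∀ y ∈ C, x ≠ y → inner ℝ x y ≤ 1 / (((k + 1 : ℕ) : ℝ) + 2) := by
    intro x hx y hy hxy
    have e : (((k + 1 : ℕ) : ℝ) + 2) = (k : ℝ) + 3 := by push_cast; ring
    rw [e]
    exact h2 x hx y hy hxy
  obtain ⟨a, ha, S, hS, hS1, hS2⟩ := exists_touching_of_code (k := k + 1) C h1 h2'
  obtain ⟨C', hC', h1', h2''⟩ := exists_code_of_touching_cast (m := n + (k + 1)) (n := n + 1) (k := k) (by omega)
    (fun i => a (Fin.castSucc i)) (fun i j hij => ha _ _ (fun e => hij (Fin.castSucc_injective _ e))) S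
    (fun c hc i => hS1 c hc _) hS2
  exact ⟨C', hC'.trans hS, h1', h2''⟩

/-- **Bound transfer down the diagonal.** An upper bound `N` for codes of `ℝⁿ⁺¹` at angle `arccos 1/(k+2)` is an upper
bound for codes of `ℝⁿ` at angle `arccos 1/(k+3)`: `A(n, arccos 1/(k+3)) ≤ A(n+1, arccos 1/(k+2)) ≤ N`.
[cite: ConwaySloane1999, Ch. 14 Theorem 1] -/
theorem code_card_le_of_succ_bound {n k N : ℕ}
    (hN : ∀ C' : Finset (EuclideanSpace ℝ (Fin (n + 1))), (∀ x ∈ C', ‖x‖ = 1) →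
      (∀ x ∈ C', ∀ y ∈ C', x ≠ y → inner ℝ x y ≤ 1 / ((k : ℝ) + 2)) → C'.card ≤ N)
    (C : Finset (EuclideanSpace ℝ (Fin n))) (h1 : ∀ x ∈ C, ‖x‖ = 1)
    (h2 : ∀ x ∈ C, ∀ y ∈ C, x ≠ y → inner ℝ x y ≤ 1 / ((k : ℝ) + 3)) : C.card ≤ N := by
  obtain ⟨C', hC', h1', h2'⟩ := exists_code_succ_of_code C h1 h2
  rw [← hC']
  exact hN C' h1' h2'

/-- **Top of the diagonal (`k = 0`): a `1/3`-code of `ℝⁿ` has the size of a kissing configuration of `ℝⁿ⁺¹`**, i.e.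
`A(n, arccos 1/3) ≤ κ(n + 1)` ("spheres touching two touching spheres are among the spheres touching one sphere").
[cite: ConwaySloane1999, Ch. 9 Table 9.2] -/
theorem card_mem_kissingSizes_succ_of_third_code {n : ℕ} (C : Finset (EuclideanSpace ℝ (Fin n)))
    (h1 : ∀ x ∈ C, ‖x‖ = 1) (h2 : ∀ x ∈ C, ∀ y ∈ C, x ≠ y → inner ℝ x y ≤ 1 / 3) :
    C.card ∈ Config.kissingSizes (n + 1) := by
  obtain ⟨C', hC', h1', h2'⟩ := exists_code_succ_of_code (k := 0) C h1
    (fun x hx y hy hxy => (h2 x hx y hy hxy).trans_eq (by norm_num))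
  exact ⟨C', hC', h1', fun x hx y hy hxy => (h2' x hx y hy hxy).trans_eq (by norm_num)⟩

end Summit.Ventures.PackingBounds.SphericalCodes
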